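import Literature.MathematicalPhysics.QuantumChemistry.T2Condition
import Literature.MathematicalPhysics.QuantumChemistry.ColemanOneMatrixRepresentability
import Literature.MathematicalPhysics.QuantumChemistry.SlaterDeterminantRDMs
import HarnessLib

/-!
# The `T2` condition in the Zhao–Braams–Fukuda–Overton–Percus convention: the printed index form
# (Chaykin 2009, eq. (3.23)), a one-sign print defect, and the identification with the tree's `T2`

Topic `Literature/MathematicalPhysics/QuantumChemistry`; the `T2` twin of `T1ConditionZhaoForm.lean`
(the printed `T1` form (3.22) of the same page, `t1Zhao`) and a sibling of `T2Condition.lean`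
(`T2Condition γ Γ := t2Map γ Γ ⪰ 0`) / `T2ConditionPrinted.lean` (Braams–Percus–Zhao's antisymmetriser
form). HONEST FRAMING (cell chem-oracle): a printed formula typed verbatim, kernel-checked identities
between index conventions, and a kernel-checked FACT ABOUT THE PRINT; no number is certified; nothing about
molecules. WHAT THIS FILE IS NOT: not a new condition — the (corrected) matrix typed here is a re-indexing
of the tree's `t2Map` — and not the `T2′` form (the thesis does not print `T2′`).

THE PRINTED STATEMENT (page opened 2026-08-27: D. Chaykin, *Verification of Semidefinite Optimization
Problems with Application to Variational Electronic Structure Calculation*, Dr.-Ing. thesis, TU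
Hamburg-Harburg 2009, Ch. 3 §3.3 "N-representability", printed p. 33 = page file p0043 of the open TORE
copy `paper:url-021c0d30f216`; the thesis cites Fukuda et al., Math. Program. B 109 (2007) 553 and Zhao,
Braams, Fukuda, Overton, Percus, J. Chem. Phys. 120 (2004) 2095 for it). After (3.18) "`P ⪰ 0, G ⪰ 0,
Q ⪰ 0, T1 ⪰ 0, T2 ⪰ 0`" and (3.22):
`T2(i,j,k;i′,j′,k′) ≡ δ(i,i′)Γ(j′,k′;j,k) − δ(j,j′)Γ(k′,i;k,i′)`
`  − δ(k,k′)Γ(j′,i;j,i′) − δ(j,k′)Γ(j′,i;k,i′)`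
`  + δ(k,j′)Γ(k′,i;j,i′)`
`  + δ(k,k′)δ(j,j′)γ(i,i′) − δ(j,k′)δ(k,j′)γ(i,i′).` (3.23)
"In the above definitions all indices range over `1, …, r` and `δ` is the Kronecker delta." The thesis's
reduced density matrices are REAL SYMMETRIC, `Γ` antisymmetric in each index pair (3.8), normalised by
`trace(Γ) = N(N − 1)` (3.4), and — as established for (3.20)–(3.22) in `T1ConditionZhaoForm.lean` — are the
TRANSPOSES of the tree's: `γ(i,i′) = ⟨a†_{i′} a_i⟩ = (oneRDM ψ)ᵀ i i′`,
`Γ(i,j;i′,j′) = ⟨a†_{i′} a†_{j′} a_j a_i⟩ = (twoRDM ψ)ᵀ (i,j) (i′,j′)`.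
[cite: Chaykin2009Thesis, §3.3 eqs. (3.18), (3.23), pp. 32-33]

WHAT IS TYPED AND PROVED HERE (0 sorry, no named fact; two definitions = the displayed formula as printed
and with one sign corrected, one definition = the index rotation):
* `t2ZhaoPrinted γ Γ` — eq. (3.23) VERBATIM as a matrix on `ι × ι × ι` (rows `(i,j,k)`, columns
  `(i′,j′,k′)`), reading `δ(x,y) ↦ (if x = y then 1 else 0)`, `γ(x,y) ↦ γ x y`, `Γ(x,y;z,w) ↦ Γ (x,y) (z,w)`.
* `t2Zhao γ Γ` — the same with the FOURTH term's sign corrected, `+ δ(j,k′)Γ(j′,i;k,i′)`;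
  `t2ZhaoPrinted_apply_eq`: printed `=` corrected `− 2·δ(j,k′)·Γ(j′,i;k,i′)`.
* **AUDIT VERDICT — the printed sign is a defect of the print, not a convention**:
  (i) `t2Zhao_transpose_apply_eq_t2Map` / `t2Zhao_transpose_eq_t2Map_submatrix`: for every `γ` and every
  PAIR-ANTISYMMETRIC `Γ`, `t2Zhao γᵀ Γᵀ (i,j,k) (i′,j′,k′) = t2Map γ Γ (j,k,i) (j′,k′,i′)` — i.e. with the
  thesis's own (transposed) RDMs the corrected (3.23) IS Nakata et al.'s / Mazziotti's `T2` (the tree's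
  `t2Map`, operator family `a†_j a†_k a_i`) under the index rotation `tripleRot (i,j,k) = (j,k,i)`; hence
  `t2Zhao ⪰ 0 ⟺ T2Condition` (`t2Zhao_posSemidef_iff_t2Condition`) and `t2Zhao` of every state's pair is
  positive semidefinite (`t2Zhao_rdm_transpose_posSemidef`);
  (ii) `t2ZhaoPrinted_single_univ_not_isHermitian` / `…_not_posSemidef`: for the Slater determinant with
  all three spin orbitals of `Fin 3` occupied (an `N = 3` state; its own pair `γ = 1`, `Γ = ²Dᵀ`), the
  PRINTED matrix has entries `T2(2,1,2;0,0,1) = 1 ≠ −1 = T2(0,0,1;2,1,2)` — not symmetric, so "`T2 ⪰ 0`"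
  with (3.23) as printed FAILS on an `N`-representable pair and is not an `N`-representability condition;
  (iii) `trace_t2ZhaoPrinted`: `tr T2_printed = tr T2 − 2 Σ_{i,j} Γ(j,i;j,i)` (`= tr T2 − 2N(N−1)` at the
  thesis's normalisation) — the `2N(N−1)` by which the printed trace formula (4.5) of Chaykin et al. (2016)
  was found short of the kernel value in the cell's audit of `T2ConditionTrace.lean` (AUDIT-05b): the 2016
  slip is inherited from (3.23).
  The sign is also forced by symmetry alone: under the relabelling `(j,k;j′,k′) ↦ (k,j;k′,j′)` (two
  antisymmetry signs cancel) the 4th and 5th terms of (3.23) must map onto each other, which the printed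
  signs `−/+` violate; of the two sign-consistent repairs only `+/+` is a Gram/anticommutator form
  (numerical audit note in the cell, not a theorem here).

Deliberately NOT here: spin blocks (3.24)–(3.29) (tree: `SpinBlockTraces.lean`, `ErdahlT1SpinBlocks.lean`
patterns), the `T2′` border (not in the thesis), traces of the corrected form (`T2ConditionTrace.lean`).
-/

noncomputable section

namespace Literature.MathematicalPhysics.QuantumChemistry

open Matrix Finset Literature.MathematicalPhysics.QuantumLattice
open scoped ComplexOrder

/-! ### The printed formula (3.23), verbatim and corrected -/

section Printed

variable {ι : Type*} [LinearOrder ι]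

/-- **Chaykin's (3.23) AS PRINTED** (Zhao–Braams–Fukuda–Overton–Percus convention), typed verbatim with
`(i′,j′,k′) = (l,m,n)`: `T2(i,j,k;l,m,n) = δ(i,l)Γ(m,n;j,k) − δ(j,m)Γ(n,i;k,l) − δ(k,n)Γ(m,i;j,l)
− δ(j,n)Γ(m,i;k,l) + δ(k,m)Γ(n,i;j,l) + δ(k,n)δ(j,m)γ(i,l) − δ(j,n)δ(k,m)γ(i,l)`. See
`t2ZhaoPrinted_single_univ_not_posSemidef`: with this sign pattern the matrix of an `N`-representable pair
need not be symmetric — the fourth sign is a print defect (`t2Zhao`).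
[cite: Chaykin2009Thesis, §3.3 eq. (3.23), p. 33] -/
def t2ZhaoPrinted (γ : Matrix ι ι ℂ) (Γ : Matrix (ι × ι) (ι × ι) ℂ) :
    Matrix (ι × ι × ι) (ι × ι × ι) ℂ :=
  Matrix.of fun I J =>
    let i := I.1; let j := I.2.1; let k := I.2.2; let l := J.1; let m := J.2.1; let n := J.2.2
    (if i = l then (1 : ℂ) else 0) * Γ (m, n) (j, k)
    - (if j = m then (1 : ℂ) else 0) * Γ (n, i) (k, l)
    - (if k = n then (1 : ℂ) else 0) * Γ (m, i) (j, l)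
    - (if j = n then (1 : ℂ) else 0) * Γ (m, i) (k, l)
    + (if k = m then (1 : ℂ) else 0) * Γ (n, i) (j, l)
    + (if k = n then (1 : ℂ) else 0) * (if j = m then (1 : ℂ) else 0) * γ i l
    - (if j = n then (1 : ℂ) else 0) * (if k = m then (1 : ℂ) else 0) * γ i l

/-- **Chaykin's (3.23) with the fourth sign CORRECTED** (`+ δ(j,k′)Γ(j′,i;k,i′)`): the `T2` matrix of the
Zhao–Braams–Fukuda–Overton–Percus convention — rows `(i; j,k)` label the operators `a†_j a†_k a_i` in the
thesis's transposed RDM dictionary (`t2Zhao_transpose_apply_eq_t2Map`).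
[cite: Chaykin2009Thesis, §3.3 eq. (3.23), p. 33] -/
def t2Zhao (γ : Matrix ι ι ℂ) (Γ : Matrix (ι × ι) (ι × ι) ℂ) : Matrix (ι × ι × ι) (ι × ι × ι) ℂ :=
  Matrix.of fun I J =>
    let i := I.1; let j := I.2.1; let k := I.2.2; let l := J.1; let m := J.2.1; let n := J.2.2
    (if i = l then (1 : ℂ) else 0) * Γ (m, n) (j, k)
    - (if j = m then (1 : ℂ) else 0) * Γ (n, i) (k, l)
    - (if k = n then (1 : ℂ) else 0) * Γ (m, i) (j, l)
    + (if j = n then (1 : ℂ) else 0) * Γ (m, i) (k, l)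
    + (if k = m then (1 : ℂ) else 0) * Γ (n, i) (j, l)
    + (if k = n then (1 : ℂ) else 0) * (if j = m then (1 : ℂ) else 0) * γ i l
    - (if j = n then (1 : ℂ) else 0) * (if k = m then (1 : ℂ) else 0) * γ i l

/-- Entries of `t2ZhaoPrinted` (`rfl`). [cite: Chaykin2009Thesis, §3.3 eq. (3.23), p. 33] -/
theorem t2ZhaoPrinted_apply (γ : Matrix ι ι ℂ) (Γ : Matrix (ι × ι) (ι × ι) ℂ) (i j k l m n : ι) :
    t2ZhaoPrinted γ Γ (i, j, k) (l, m, n) =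
      (if i = l then (1 : ℂ) else 0) * Γ (m, n) (j, k)
      - (if j = m then (1 : ℂ) else 0) * Γ (n, i) (k, l)
      - (if k = n then (1 : ℂ) else 0) * Γ (m, i) (j, l)
      - (if j = n then (1 : ℂ) else 0) * Γ (m, i) (k, l)
      + (if k = m then (1 : ℂ) else 0) * Γ (n, i) (j, l)
      + (if k = n then (1 : ℂ) else 0) * (if j = m then (1 : ℂ) else 0) * γ i l
      - (if j = n then (1 : ℂ) else 0) * (if k = m then (1 : ℂ) else 0) * γ i l := rfl

/-- Entries of `t2Zhao` (`rfl`). [cite: Chaykin2009Thesis, §3.3 eq. (3.23), p. 33] -/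
theorem t2Zhao_apply (γ : Matrix ι ι ℂ) (Γ : Matrix (ι × ι) (ι × ι) ℂ) (i j k l m n : ι) :
    t2Zhao γ Γ (i, j, k) (l, m, n) =
      (if i = l then (1 : ℂ) else 0) * Γ (m, n) (j, k)
      - (if j = m then (1 : ℂ) else 0) * Γ (n, i) (k, l)
      - (if k = n then (1 : ℂ) else 0) * Γ (m, i) (j, l)
      + (if j = n then (1 : ℂ) else 0) * Γ (m, i) (k, l)
      + (if k = m then (1 : ℂ) else 0) * Γ (n, i) (j, l)
      + (if k = n then (1 : ℂ) else 0) * (if j = m then (1 : ℂ) else 0) * γ i l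
      - (if j = n then (1 : ℂ) else 0) * (if k = m then (1 : ℂ) else 0) * γ i l := rfl

/-- **Printed = corrected − 2·δ(j,k′)·Γ(j′,i;k,i′)**: the two typings differ exactly in the sign of the
fourth term. [cite: Chaykin2009Thesis, §3.3 eq. (3.23), p. 33] -/
theorem t2ZhaoPrinted_apply_eq (γ : Matrix ι ι ℂ) (Γ : Matrix (ι × ι) (ι × ι) ℂ) (i j k l m n : ι) :
    t2ZhaoPrinted γ Γ (i, j, k) (l, m, n) =
      t2Zhao γ Γ (i, j, k) (l, m, n) - 2 * ((if j = n then (1 : ℂ) else 0) * Γ (m, i) (k, l)) := by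
  rw [t2ZhaoPrinted_apply, t2Zhao_apply]
  ring

/-- Plumbing: a Kronecker delta is symmetric, `δ(x,y) = δ(y,x)`. [folklore] -/
private theorem delta_comm (x y : ι) :
    (if x = y then (1 : ℂ) else 0) = (if y = x then (1 : ℂ) else 0) := by
  by_cases h : x = y
  · rw [if_pos h, if_pos h.symm]
  · rw [if_neg h, if_neg (Ne.symm h)]

/-- **The index rotation `(i, j, k) ↦ (j, k, i)`** translating the thesis's row label `(i; j,k)` (one
annihilator `a_i`, creator pair `a†_j a†_k`) into the tree's row label `(j, k, i)` of `a†_j a†_k a_i`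
(`twoCreateAnnihilate`); an equivalence with inverse `(i, j, k) ↦ (k, i, j)`.
[cite: Chaykin2009Thesis, §3.3 eq. (3.23), p. 33] -/
def tripleRot (ι : Type*) : ι × ι × ι ≃ ι × ι × ι where
  toFun t := (t.2.1, t.2.2, t.1)
  invFun t := (t.2.2, t.1, t.2.1)
  left_inv _ := rfl
  right_inv _ := rfl

omit [LinearOrder ι] in
/-- The rotation on components (`rfl`). [cite: Chaykin2009Thesis, §3.3 eq. (3.23), p. 33] -/
theorem tripleRot_apply (i j k : ι) : tripleRot ι (i, j, k) = (j, k, i) := rfl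

/-! ### Identification with the tree's `T2` functional -/

/-- **The tree's `T2` functional commutes with transposition of both arguments**:
`t2Map γᵀ Γᵀ = (t2Map γ Γ)ᵀ` (formal identity in the entries of Nakata et al.'s display; no hypothesis).
[cite: NakataEtAl2008, §II.A] -/
theorem t2Map_transpose (γ : Matrix ι ι ℂ) (Γ : Matrix (ι × ι) (ι × ι) ℂ) :
    t2Map γᵀ Γᵀ = (t2Map γ Γ)ᵀ := by
  ext ⟨i, j, k⟩ ⟨l, m, n⟩
  rw [transpose_apply, t2Map_apply, t2Map_apply]
  simp only [transpose_apply]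
  rw [delta_comm l i, delta_comm l j, delta_comm m i, delta_comm m j, delta_comm k n]
  ring

/-- **The corrected (3.23), fed the TRANSPOSED pair, is the tree's `T2` functional under the rotation**:
for every `γ` and every pair-antisymmetric `Γ` (the thesis's (3.8); `swap_fst`/`swap_snd` of
`IsDQGFeasible`; every `twoRDM ψ`),
`t2Zhao γᵀ Γᵀ (i,j,k) (i′,j′,k′) = t2Map γ Γ (j,k,i) (j′,k′,i′)`. Term by term: the five `Γ`-terms of
(3.23) are Nakata et al.'s five with both index pairs reversed (two sign flips cancel), the `γ`-terms agree
literally. [cite: Chaykin2009Thesis, §3.3 eqs. (3.8), (3.23), pp. 30, 33] -/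
theorem t2Zhao_transpose_apply_eq_t2Map (γ : Matrix ι ι ℂ)
    {Γ : Matrix (ι × ι) (ι × ι) ℂ} (hΓ1 : ∀ a b q, Γ (b, a) q = -Γ (a, b) q)
    (hΓ2 : ∀ p c e, Γ p (e, c) = -Γ p (c, e)) (i j k l m n : ι) :
    t2Zhao γᵀ Γᵀ (i, j, k) (l, m, n) = t2Map γ Γ (j, k, i) (m, n, l) := by
  have r1 : ∀ q, Γ (k, l) q = -Γ (l, k) q := fun q => hΓ1 l k q
  have r2 : ∀ q, Γ (j, l) q = -Γ (l, j) q := fun q => hΓ1 l j q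
  have c1 : ∀ p, Γ p (n, i) = -Γ p (i, n) := fun p => hΓ2 p i n
  have c2 : ∀ p, Γ p (m, i) = -Γ p (i, m) := fun p => hΓ2 p i m
  rw [t2Zhao_apply, t2Map_apply]
  simp only [transpose_apply]
  simp only [r1, r2, c1, c2]
  rw [delta_comm j m, delta_comm k n, delta_comm j n, delta_comm k m]
  ring

/-- Matrix form: `t2Zhao γᵀ Γᵀ = (t2Map γ Γ).submatrix ρ ρ` with `ρ = tripleRot ι`, for pair-antisymmetric
`Γ`. [cite: Chaykin2009Thesis, §3.3 eqs. (3.8), (3.23), pp. 30, 33] -/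
theorem t2Zhao_transpose_eq_t2Map_submatrix (γ : Matrix ι ι ℂ)
    {Γ : Matrix (ι × ι) (ι × ι) ℂ} (hΓ1 : ∀ a b q, Γ (b, a) q = -Γ (a, b) q)
    (hΓ2 : ∀ p c e, Γ p (e, c) = -Γ p (c, e)) :
    t2Zhao γᵀ Γᵀ = (t2Map γ Γ).submatrix (tripleRot ι) (tripleRot ι) := by
  ext ⟨i, j, k⟩ ⟨l, m, n⟩
  rw [submatrix_apply, tripleRot_apply, tripleRot_apply]
  exact t2Zhao_transpose_apply_eq_t2Map γ hΓ1 hΓ2 i j k l m n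

/-- With the tree's (Mazziotti) pair plugged into the corrected (3.23) UNCHANGED one obtains the rotated
TRANSPOSE of the tree's `T2`: `t2Zhao γ Γ = (t2Map γ Γ)ᵀ.submatrix ρ ρ` for pair-antisymmetric `Γ`
(`t2Map_transpose`). [cite: Chaykin2009Thesis, §3.3 eqs. (3.8), (3.23), pp. 30, 33] -/
theorem t2Zhao_eq_t2Map_transpose_submatrix (γ : Matrix ι ι ℂ)
    {Γ : Matrix (ι × ι) (ι × ι) ℂ} (hΓ1 : ∀ a b q, Γ (b, a) q = -Γ (a, b) q)
    (hΓ2 : ∀ p c e, Γ p (e, c) = -Γ p (c, e)) :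
    t2Zhao γ Γ = (t2Map γ Γ)ᵀ.submatrix (tripleRot ι) (tripleRot ι) := by
  have h1 : ∀ a b q, Γᵀ (b, a) q = -Γᵀ (a, b) q := fun a b q => by
    simp only [transpose_apply]; exact hΓ2 q a b
  have h2 : ∀ p c e, Γᵀ p (e, c) = -Γᵀ p (c, e) := fun p c e => by
    simp only [transpose_apply]; exact hΓ1 c e p
  have h := t2Zhao_transpose_eq_t2Map_submatrix γᵀ h1 h2
  rw [transpose_transpose, transpose_transpose, t2Map_transpose] at h
  exact h

/-- **`T2 ⪰ 0` (3.18) in the Zhao convention ⟺ the tree's `t2Map γ Γ ⪰ 0`** for pair-antisymmetric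
`Γ`: re-indexing by the rotation and transposition both preserve positive semidefiniteness
(`Matrix.posSemidef_submatrix_equiv`, `Matrix.posSemidef_transpose_iff`).
[cite: Chaykin2009Thesis, §3.3 eqs. (3.18), (3.23), pp. 32-33] -/
theorem t2Zhao_posSemidef_iff [Fintype ι] (γ : Matrix ι ι ℂ)
    {Γ : Matrix (ι × ι) (ι × ι) ℂ} (hΓ1 : ∀ a b q, Γ (b, a) q = -Γ (a, b) q)
    (hΓ2 : ∀ p c e, Γ p (e, c) = -Γ p (c, e)) :
    (t2Zhao γ Γ).PosSemidef ↔ (t2Map γ Γ).PosSemidef := by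
  rw [t2Zhao_eq_t2Map_transpose_submatrix γ hΓ1 hΓ2, Matrix.posSemidef_submatrix_equiv,
    Matrix.posSemidef_transpose_iff]

/-- `T2 ⪰ 0` (3.18) in the Zhao convention ⟺ `T2Condition γ Γ` (`T2Condition.lean`), for pair-antisymmetric
`Γ`. [cite: Chaykin2009Thesis, §3.3 eqs. (3.18), (3.23), pp. 32-33] -/
theorem t2Zhao_posSemidef_iff_t2Condition [Fintype ι] (γ : Matrix ι ι ℂ)
    {Γ : Matrix (ι × ι) (ι × ι) ℂ} (hΓ1 : ∀ a b q, Γ (b, a) q = -Γ (a, b) q)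
    (hΓ2 : ∀ p c e, Γ p (e, c) = -Γ p (c, e)) : (t2Zhao γ Γ).PosSemidef ↔ T2Condition γ Γ := by
  rw [t2Zhao_posSemidef_iff γ hΓ1 hΓ2, t2Condition_iff]

/-- At every `PQGT1T2`-feasible point (`IsDQGT1T2Feasible`, `T2Condition.lean`) the corrected Zhao-form
`T2` is positive semidefinite — a certificate stated against (3.23) (corrected) certifies the same feasible
set. [cite: Chaykin2009Thesis, §3.3 eq. (3.18), p. 32] -/
theorem IsDQGT1T2Feasible.t2Zhao_posSemidef [Fintype ι] {N : ℕ} {γ : Matrix ι ι ℂ}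
    {Γ : Matrix (ι × ι) (ι × ι) ℂ} (h : IsDQGT1T2Feasible N γ Γ) : (t2Zhao γ Γ).PosSemidef :=
  (t2Zhao_posSemidef_iff γ h.swap_fst h.swap_snd).mpr h.t2_psd

end Printed

/-! ### The thesis's RDM dictionary: `γ = (oneRDM ψ)ᵀ`, `Γ = (twoRDM ψ)ᵀ` -/

section State

variable {ι : Type*} [LinearOrder ι] [Fintype ι]

/-- **The corrected (3.23) of the thesis's own pair is the tree's `T2` matrix of the state, rotated**:
`t2Zhao (oneRDM ψ)ᵀ (twoRDM ψ)ᵀ = (t2Map (oneRDM ψ) (twoRDM ψ)).submatrix ρ ρ` for every Fock-space vector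
`ψ` (`twoRDM ψ` is pair-antisymmetric, `twoRDM_swap_fst/snd`). [cite: Chaykin2009Thesis, §3.3 eq. (3.23), p. 33] -/
theorem t2Zhao_rdm_transpose (ψ : Fock ι) :
    t2Zhao (oneRDM ψ)ᵀ (twoRDM ψ)ᵀ =
      (t2Map (oneRDM ψ) (twoRDM ψ)).submatrix (tripleRot ι) (tripleRot ι) :=
  t2Zhao_transpose_eq_t2Map_submatrix (oneRDM ψ) (twoRDM_swap_fst ψ) (twoRDM_swap_snd ψ)

/-- … entry for entry it is the anticommutator form of the operators `B_{(i;j,k)} = a†_j a†_k a_i`: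
`t2Zhao (¹Dᵀ, ²Dᵀ)(i,j,k; i′,j′,k′) = ⟨ψ| B B′† + B′† B |ψ⟩` (`t2Map_rdm`: the tree's `T2` of a state is
the metric matrix of `a†a†a` plus the transposed metric matrix of its adjoints).
[cite: Chaykin2009Thesis, §3.3 eq. (3.23), p. 33] -/
theorem t2Zhao_rdm_transpose_apply (ψ : Fock ι) (i j k l m n : ι) :
    t2Zhao (oneRDM ψ)ᵀ (twoRDM ψ)ᵀ (i, j, k) (l, m, n) =
      (metricMatrix twoCreateAnnihilate ψ +
        (metricMatrix (fun t : ι × ι × ι => (twoCreateAnnihilate t)ᴴ) ψ)ᵀ) (j, k, i) (m, n, l) := by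
  rw [t2Zhao_rdm_transpose, submatrix_apply, tripleRot_apply, tripleRot_apply, t2Map_rdm]

/-- **`T2 ⪰ 0` (3.18) is NECESSARY, in the thesis's convention, once the sign is corrected**: for every
vector `ψ` of the fermionic Fock space, `t2Zhao` of the pair `((oneRDM ψ)ᵀ, (twoRDM ψ)ᵀ)` is positive
semidefinite (`t2Map_rdm`, `t2Anticomm_posSemidef`, re-indexed).
[cite: Chaykin2009Thesis, §3.3 eqs. (3.18), (3.23), pp. 32-33] -/
theorem t2Zhao_rdm_transpose_posSemidef (ψ : Fock ι) :
    (t2Zhao (oneRDM ψ)ᵀ (twoRDM ψ)ᵀ).PosSemidef := by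
  rw [t2Zhao_rdm_transpose ψ, Matrix.posSemidef_submatrix_equiv, t2Map_rdm]
  exact t2Anticomm_posSemidef ψ

/-- With the tree's (Mazziotti) pair plugged in unchanged: `t2Zhao (oneRDM ψ) (twoRDM ψ)` is the rotated
transpose of the state's `T2` matrix, positive semidefinite as well.
[cite: Chaykin2009Thesis, §3.3 eqs. (3.18), (3.23), pp. 32-33] -/
theorem t2Zhao_rdm_posSemidef (ψ : Fock ι) : (t2Zhao (oneRDM ψ) (twoRDM ψ)).PosSemidef := by
  rw [t2Zhao_eq_t2Map_transpose_submatrix (oneRDM ψ) (twoRDM_swap_fst ψ) (twoRDM_swap_snd ψ),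
    Matrix.posSemidef_submatrix_equiv, Matrix.posSemidef_transpose_iff, t2Map_rdm]
  exact t2Anticomm_posSemidef ψ

/-- A pure-state `N`-representable pair satisfies the corrected Zhao-form `T2 ⪰ 0`.
[cite: Chaykin2009Thesis, §3.3 eq. (3.18), p. 32] -/
theorem IsPureNRepresentable.t2Zhao_posSemidef {N : ℕ} {γ : Matrix ι ι ℂ}
    {Γ : Matrix (ι × ι) (ι × ι) ℂ} (h : IsPureNRepresentable N γ Γ) : (t2Zhao γ Γ).PosSemidef :=
  h.isDQGT1T2PrimeFeasible.toIsDQGT1T2Feasible.t2Zhao_posSemidef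

/-- An ensemble `N`-representable pair satisfies the corrected Zhao-form `T2 ⪰ 0`.
[cite: Chaykin2009Thesis, §3.3 eq. (3.18), p. 32] -/
theorem IsEnsembleNRepresentable.t2Zhao_posSemidef {N : ℕ} {γ : Matrix ι ι ℂ}
    {Γ : Matrix (ι × ι) (ι × ι) ℂ} (h : IsEnsembleNRepresentable N γ Γ) : (t2Zhao γ Γ).PosSemidef :=
  h.isDQGT1T2Feasible.t2Zhao_posSemidef

end State

/-! ### The print defect, kernel-checked: (3.23) as printed fails on a Slater determinant -/

section PrintDefect

/-- The witness state: the occupation-number vector of `Fin 3` with ALL THREE spin orbitals occupied (a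
normalised `3`-particle Slater determinant; `oneRDM = 1`, `twoRDM^{ij}_{kl} = δ_ik δ_jl − δ_il δ_jk`,
`oneRDM_single` / `twoRDM_single`). For its own pair in the thesis's convention
(`γ = (oneRDM ψ₀)ᵀ`, `Γ = (twoRDM ψ₀)ᵀ`) the PRINTED (3.23) has the entry
`T2(2,1,2; 0,0,1) = 1` … [cite: Chaykin2009Thesis, §3.3 eq. (3.23), p. 33] -/
theorem t2ZhaoPrinted_single_univ_apply₁ :
    t2ZhaoPrinted (oneRDM (Pi.single (univ : Finset (Fin 3)) (1 : ℂ)))ᵀ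
        (twoRDM (Pi.single (univ : Finset (Fin 3)) (1 : ℂ)))ᵀ ((2 : Fin 3), 1, 2) (0, 0, 1) = 1 := by
  rw [t2ZhaoPrinted_apply]
  simp only [transpose_apply, oneRDM_single, twoRDM_single, mem_univ, and_true, and_self, true_and]
  simp (config := { decide := true })

/-- … and the transposed entry `T2(0,0,1; 2,1,2) = −1`: both rows are "sorted" labels (`j < k`), so the
defect is visible also on the antisymmetry-reduced index set used by SDP codes.
[cite: Chaykin2009Thesis, §3.3 eq. (3.23), p. 33] -/
theorem t2ZhaoPrinted_single_univ_apply₂ :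
    t2ZhaoPrinted (oneRDM (Pi.single (univ : Finset (Fin 3)) (1 : ℂ)))ᵀ
        (twoRDM (Pi.single (univ : Finset (Fin 3)) (1 : ℂ)))ᵀ ((0 : Fin 3), 0, 1) (2, 1, 2) = -1 := by
  rw [t2ZhaoPrinted_apply]
  simp only [transpose_apply, oneRDM_single, twoRDM_single, mem_univ, and_true, and_self, true_and]
  simp (config := { decide := true })

/-- **THE PRINT DEFECT**: (3.23) as printed, evaluated on the thesis-convention RDM pair of the fully
occupied `Fin 3` determinant, is NOT Hermitian (`1 ≠ −1` across the diagonal) …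
[cite: Chaykin2009Thesis, §3.3 eq. (3.23), p. 33] -/
theorem t2ZhaoPrinted_single_univ_not_isHermitian :
    ¬ (t2ZhaoPrinted (oneRDM (Pi.single (univ : Finset (Fin 3)) (1 : ℂ)))ᵀ
        (twoRDM (Pi.single (univ : Finset (Fin 3)) (1 : ℂ)))ᵀ).IsHermitian := by
  intro h
  have h12 := h.apply ((2 : Fin 3), 1, 2) (0, 0, 1)
  rw [t2ZhaoPrinted_single_univ_apply₁, t2ZhaoPrinted_single_univ_apply₂] at h12
  norm_num at h12

/-- … hence NOT positive semidefinite: "`T2 ⪰ 0`" with (3.23) AS PRINTED fails on an `N`-representable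
(indeed single-determinant) pair, so the printed formula is not an `N`-representability condition; with
the fourth sign corrected it is (`t2Zhao_rdm_transpose_posSemidef`).
[cite: Chaykin2009Thesis, §3.3 eqs. (3.18), (3.23), pp. 32-33] -/
theorem t2ZhaoPrinted_single_univ_not_posSemidef :
    ¬ (t2ZhaoPrinted (oneRDM (Pi.single (univ : Finset (Fin 3)) (1 : ℂ)))ᵀ
        (twoRDM (Pi.single (univ : Finset (Fin 3)) (1 : ℂ)))ᵀ).PosSemidef :=
  fun h => t2ZhaoPrinted_single_univ_not_isHermitian h.1

/-- The corrected form at the same witness IS positive semidefinite (instance of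
`t2Zhao_rdm_transpose_posSemidef`). [cite: Chaykin2009Thesis, §3.3 eqs. (3.18), (3.23), pp. 32-33] -/
theorem t2Zhao_single_univ_posSemidef :
    (t2Zhao (oneRDM (Pi.single (univ : Finset (Fin 3)) (1 : ℂ)))ᵀ
        (twoRDM (Pi.single (univ : Finset (Fin 3)) (1 : ℂ)))ᵀ).PosSemidef :=
  t2Zhao_rdm_transpose_posSemidef _

end PrintDefect

/-! ### The trace of the printed form: short by `2 Σ_{ij} Γ(j,i;j,i)` (`= 2N(N−1)`) -/

section Trace

variable {ι : Type*} [LinearOrder ι] [Fintype ι]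

/-- **Trace of the printed form**: `tr T2_printed = tr T2_corrected − 2 Σ_{i,j} Γ(j,i;j,i)`; at the thesis's
normalisation `Σ_{i,j} Γ(i,j;i,j) = N(N−1)` (3.16) the printed formula's trace is short by `2N(N−1)` —
the amount by which the printed a-priori trace `tr T2 = rN(r−N)` of Chaykin et al. (2016) eq. (4.5) falls
below the kernel value `rN(r−N) + 2N(N−1)` (`T2ConditionTrace.lean`).
[cite: Chaykin2009Thesis, §3.3 eqs. (3.16), (3.23), pp. 32-33] -/
theorem trace_t2ZhaoPrinted (γ : Matrix ι ι ℂ) (Γ : Matrix (ι × ι) (ι × ι) ℂ) :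
    (t2ZhaoPrinted γ Γ).trace = (t2Zhao γ Γ).trace - 2 * ∑ i, ∑ j, Γ (j, i) (j, i) := by
  simp only [Matrix.trace, Matrix.diag, Fintype.sum_prod_type]
  have : ∀ i j k : ι, t2ZhaoPrinted γ Γ (i, j, k) (i, j, k) =
      t2Zhao γ Γ (i, j, k) (i, j, k) - 2 * ((if j = k then (1 : ℂ) else 0) * Γ (j, i) (k, i)) :=
    fun i j k => t2ZhaoPrinted_apply_eq γ Γ i j k i j k
  simp only [this, Finset.sum_sub_distrib, ← Finset.mul_sum, ite_mul, one_mul, zero_mul,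
    Finset.sum_ite_eq, Finset.mem_univ, if_true]

end Trace

end Literature.MathematicalPhysics.QuantumChemistry

end
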